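import Literature.Computability.AlgebraicComplexity.Shafiei15ApolarIdealsDetPerm
import Literature.RingTheory.MvPolynomial.HomogeneousHilbertFunction
import Literature.RingTheory.MvPolynomial.HilbertPolynomialDegree
import Mathlib.RingTheory.Ideal.AssociatedPrime.Finiteness
import HarnessLib

/-!
# Shafiei 2015, §3 for SCHEMES: the Ranestad–Schreyer bound `deg Γ ≥ (1/d)·length(S/Ann F)` for
# every zero-dimensional apolar scheme, and `½·binom(2n,n) ≤ cr(det_n), cr(perm_n)`

Topic `Literature/Computability/AlgebraicComplexity`; third file of the Shafiei 2015 group, after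
`Shafiei15ApolarIdealsDetPerm.lean` (§§1–2: `Ann(det_n)`, `Ann(perm_n)` generated by quadrics, Hilbert
function `binom(n,k)²`, length `binom(2n,n)`) and `Shafiei15WaringRankBound.lean` (§3 in the REDUCED
reading: Waring decompositions / finite point sets). This file proves the **scheme-theoretic** statements
left open there — everything is PROVED (no named facts, no new definitions).

## Sources (held texts)

* K. Ranestad, F.-O. Schreyer, *On the rank of a symmetric form*, J. Algebra **346** (2011) 340–342
  = arXiv:1104.3648 [`RanestadSchreyer2011`], p. 2 of the held text `paper:arxiv-1104.3648`:
  **Proposition 1.** "If the ideal of `F^⊥` is generated in degree `d` and `Γ ⊂ ℙ(T₁)` is a finite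
  apolar subscheme to `F`, then `deg Γ ≥ (1/d) deg F^⊥`" (`deg F^⊥ :=` "the length of the quotient
  algebra `S_F = S/F^⊥`"; "A finite subscheme `Γ ⊂ ℙ(T₁)` is apolar to `F` if the homogeneous ideal
  `I_Γ ⊂ S` is contained in `F^⊥`"). **Corollary 1.** "If the ideal of `F^⊥` is generated in degree
  `d`, then the cactus rank `cr(F) ≥ (1/d) deg F^⊥`", `cr(F) = min {deg Γ | Γ ⊂ ℙ(T₁), dim Γ = 0,
  I_Γ ⊂ F^⊥}`. Printed proof: Bézout on the cones over `Γ ⊃ V(F^⊥)` cut by a hypersurface `g = 0`,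
  `g ∈ F^⊥` of degree `d` "that does not contain any component of `Y`".
* S. M. Shafiei, *Apolarity for determinants and permanents of generic matrices*, J. Commut. Algebra
  **7** (2015) = arXiv:1212.0515 [`Shafiei2015`], §3 (`paper:arxiv-1212.0515` p0007:L59–L84):
  **Prop. 3.4** (= RS Prop. 1, verbatim) and **Thm. 3.5** "Let `F` be the determinant or permanent of
  a generic `n × n` matrix `A`. We have `½ binom(2n,n) ≤ cr(F) ≤ sr(F) ≤ r(F)`", proved from
  Thms. 2.12/2.13 (`d = 2`) and eq. (2.2) (`deg Ann(F) = binom(2n,n)`).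

## Dictionary (typed ↔ printed) — why this IS Proposition 1 and not a variant

A closed subscheme `Γ ⊂ ℙ(S₁) = Proj S` is the same thing as a SATURATED homogeneous ideal
`I = I_Γ ⊆ S` (`I : 𝔪 = I`, `𝔪` the irrelevant ideal; Hartshorne II, Ex. 5.10), and `Γ` is
zero-dimensional of degree `e ≥ 1` iff the Hilbert function of `S/I_Γ` is eventually the constant
`e` (its Hilbert polynomial; Hartshorne I.7.5–7.6), iff `dim S/I_Γ = 1` (then `e ≥ 1` automatically,
`CactusBound.exists_hilbertFunction_eventually_const'`). Accordingly the theorems below quantify over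
ideals `I` of `S = K[X_σ]` with

* `I.IsHomogeneous (homogeneousSubmodule σ K)` — `I` is a homogeneous ideal;
* `∀ f, (∀ i, X i * f ∈ I) → f ∈ I` — `I` is saturated (`I : 𝔪 = I`), spelled out, no new definition;
* `I ≤ annihilatorIdeal F` — "`Γ` is apolar to `F`" (`I_Γ ⊂ F^⊥`; `annihilatorIdeal` is Shafiei's
  `Ann(F)`, `Shafiei15ApolarIdealsDetPerm.lean`);
* `∀ t ≥ t₀, dim S_t − dim I_t = e` — "`deg Γ = e`" (the tree's Hilbert-function expression
  `finrank K (homogeneousSubmodule σ K t) - finrank K (idealDegree I t)` of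
  `HomogeneousHilbertFunction.lean`, as in the two predecessor files), resp. `ringKrullDim (S ⧸ I) = 1`
  in the dimension forms;
* "`F^⊥` generated in degree `d`" ↦ `annihilatorIdeal F = Ideal.span G` with every `g ∈ G` a form of
  degree `≤ δ` (the reading the source itself uses in its Cor. 2, where the generators
  `y_i^{d_i+1}` have several degrees and `d = d_n + 1` is the largest);
* "`deg F^⊥ = length(S/F^⊥)`" ↦ `Σ_{t ≤ T} (dim S_t − dim Ann(F)_t)`, for every `T` (the Hilbert
  function of `Ann F` vanishes above `deg F`, `hilbertFunction_annihilatorIdeal_eq_zero_of_lt`, so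
  this is the finite length once `T ≥ deg F`, `sum_hilbertFunction_annihilatorIdeal_eq_of_le`).

Saturation cannot be dropped (it is what makes `I` the ideal OF the scheme): for `F = x₀x₁`,
`Ann F = (y₀², y₁²)` (generated in degree `2`, length `4`) contains the NON-saturated ideal
`I = (y₁², y₀²y₁)`, whose Hilbert function is eventually `1` (its saturation is `(y₁)`, the reduced
point `[1:0]`, which is NOT apolar to `F`), and `4 > 2·1` — recorded here as a remark only.

## Contents (source item → declaration, all PROVED)

| source item | Lean |
|---|---|
| RS Prop. 1 = Shafiei Prop. 3.4, scheme version (Hilbert-function form, any finite `σ`) | **`sum_hilbertFunction_annihilatorIdeal_le_mul_degree`** (`Σ_{t≤T} H(S/Ann F;t) ≤ δ·e`), `…_le_mul_degree'` (`T = deg F`) |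
| RS Prop. 1, dimension form (`dim S/I = 1 ⇒ ∃ e > 0, H(S/I;·) →  e ∧ length ≤ δ·e`) | **`exists_degree_sum_hilbertFunction_annihilatorIdeal_le`** |
| RS Cor. 1 / Shafiei Thm. 3.5: `½ binom(2n,n) ≤ cr(det_n)`, `≤ cr(perm_n)` (Hilbert-function form) | **`choose_le_two_mul_degree_of_apolar_detPoly`**, **`choose_le_two_mul_degree_of_apolar_perPoly`** (`binom(2n,n) ≤ 2e`) |
| the same, dimension form | `exists_degree_choose_le_two_mul_of_apolar_detPoly`, `exists_degree_choose_le_two_mul_of_apolar_perPoly` |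
| the auxiliary hypersurface of the printed proof | `CactusBound.exists_nonZeroDivisor_mem_idealDegree` |
| Hartshorne I.7.5 at dimension zero (constant Hilbert polynomial, `e ≥ 1`) | `CactusBound.exists_hilbertFunction_eventually_const` (`Fin N`), `…_const'` (any finite `σ`) |

## Proof (the printed Bézout argument, made algebraic; all inputs are NAMED tree/Mathlib theorems)

1. (`CactusBound.exists_nonZeroDivisor_mem_idealDegree`) For `I ≠ S` saturated there is
   `g ∈ Ann(F)_δ`, `g ≠ 0`, which is a non-zero-divisor modulo `I`: the associated primes of `S/I` are
   finitely many (Mathlib `associatedPrimes.finite`), each is `(I : y)` for some `y ∉ I` (Mathlib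
   `isAssociatedPrime_iff`) and therefore misses a variable (saturation; private lemma
   `exists_X_notMem_of_isAssociatedPrime`); since `Ann(F) ⊇ 𝔪^{deg F + 1}` is generated by forms of
   degree `≤ δ`, `Ann(F)_δ ⊄ P` for each such `P` (private `not_idealDegree_annihilatorIdeal_le`); a
   vector space over an INFINITE field is not a
   finite union of proper subspaces (`exists_mem_forall_notMem_of_forall_not_le`,
   `HomogeneousHilbertFunction.lean`), and an element outside all associated primes is a
   non-zero-divisor (Mathlib `exists_le_isAssociatedPrime_of_isNoetherianRing`). This is the only use
   of `Infinite K` (the source works over any field; base change is not formalised).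
2. `I + (g) ⊆ Ann F`, so `H(S/Ann F; t) ≤ H(S/(I+(g)); t) ≤ H(S/I; t)` (`hilbert_antitone`), and the
   hypersurface-section formula for a non-zero-divisor of degree `δ` (Philippon 1986, Lemme 3.1;
   `hilbert_sup_span_add_hilbert_eq`): `H(S/(I+(g)); s+δ) + H(S/I; s) = H(S/I; s+δ)`.
3. Sliding-window telescoping (private `sum_range_le_sum_window`):
   `Σ_{t < s+δ} H(S/(I+(g)); t) ≤ Σ_{i<δ} H(S/I; s+i) = δ·e` for `s ≥ t₀`.
4. Dimension forms: the tree's `exists_hilbertPolynomial` + `natDegree_hilbertPolynomial`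
   (`HilbertPolynomialExists/Degree.lean`, stated for `Fin N` variables) give a constant Hilbert
   polynomial `≥ 1` when `dim S/I = 1`; transported to any finite `σ` by renaming the variables
   (private `hilbertFunction_map_renameEquiv`, `isHomogeneous_map_renameEquiv`; Mathlib
   `Ideal.quotientEquiv`, `RingEquiv.ringKrullDim`, `IsHomogeneous.rename_isHomogeneous_iff`).
5. `det_n`, `perm_n`: `δ = 2` by `annihilatorIdeal_detPoly` / `annihilatorIdeal_perPoly`
   (Shafiei Thms. 2.12/2.13) with `isHomogeneous_two_of_mem_generators`, and
   `Σ_{t ≤ n} H(S/Ann; t) = binom(2n,n)` is `sum_hilbertFunction_annihilatorIdeal_detPoly/_perPoly`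
   (eq. (2.2)) — cited, not restated.

Relation to the reduced case: for `Γ` a finite set of points `[ℓ_s]` (pairwise non-proportional,
non-zero) the saturated ideal `I_Γ` is radical with Hilbert function eventually `|Γ|`, so
`Shafiei15WaringRankBound.sum_hilbertFunction_annihilatorIdeal_le_mul_card` is the instance
`I = I_Γ` of the theorem here; that file proves it directly (any field for the count) and is kept as is.

NOT typed here: the smoothable rank `sr` and `cr ≤ sr ≤ r` (Prop. 3.3, Def. 3.2 b), RS Cor. 2
(monomials), Shafiei Thm. 3.6–Prop. 3.9, Examples 3.10–3.14, Rem. 3.15; no definition `cactusRank` is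
introduced (the bound is stated for every apolar zero-dimensional scheme, which is how it is used).

Honest framing: a lower bound `½ binom(2n,n)` for the cactus rank that is THE SAME for `det_n` and
`perm_n` — barrier-side bookkeeping (cf. `Literature/Barriers/ValiantsHypothesis/PartialDerivativesDetPerm.lean`,
Shafiei Rem. 3.15) recorded as an input named by the route theses `FermionizationDimension`
("cactus length of `det_n` without junk `≥ ½·C(2n,n)` (RS11 + Shafiei2015)"), `SDimPerNotQP`,
`BorderApolarity`; nothing here bears on `VP ≠ VNP`.

## References

* K. Ranestad, F.-O. Schreyer, *On the rank of a symmetric form*, J. Algebra 346 (2011) 340–342,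
  Proposition 1, Corollary 1. [`RanestadSchreyer2011`]
* S. M. Shafiei, *Apolarity for determinants and permanents of generic matrices*, J. Commut. Algebra
  7 (2015), Prop. 3.4, Thm. 3.5; arXiv:1212.0515. [`Shafiei2015`]
* R. Hartshorne, *Algebraic Geometry*, GTM 52 (1977), I.7.5–7.6, II Ex. 5.10. [`Hartshorne1977`]
* A. Iarrobino, V. Kanev, *Power sums, Gorenstein algebras, and determinantal loci*, LNM 1721
  (1999), Def. 5.1 (scheme length), Lemma 1.15. [`IarrobinoKanev1999`]
-/

noncomputable section

open MvPolynomial Module Finset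

attribute [local instance] MvPolynomial.gradedAlgebra

namespace Literature.Computability.AlgebraicComplexity

open Literature.RingTheory.MvPolynomial (idealDegree mem_idealDegree finrank_idealDegree_le
  hilbert_antitone hilbert_sup_span_add_hilbert_eq exists_mem_forall_notMem_of_forall_not_le)

namespace CactusBound

variable {K : Type*} [Field K] {σ : Type*}

/-! ### Step 0: a sliding-window telescoping for Hilbert functions -/

/-- If `b ≤ a` termwise and `b (s + δ) + a s = a (s + δ)` for all `s` (the hypersurface-section
formula for a non-zero-divisor of degree `δ`), then `Σ_{t < s + δ} b t ≤ Σ_{i < δ} a (s + i)`.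
[folklore] -/
private theorem sum_range_le_sum_window (a b : ℕ → ℕ) (δ : ℕ) (hba : ∀ t, b t ≤ a t)
    (hsec : ∀ s, b (s + δ) + a s = a (s + δ)) (s : ℕ) :
    ∑ t ∈ range (s + δ), b t ≤ ∑ i ∈ range δ, a (s + i) := by
  induction s with
  | zero =>
    simp only [zero_add]
    exact Finset.sum_le_sum fun t _ => hba t
  | succ s ih =>
    have h1 : ∑ i ∈ range (δ + 1), a (s + i) = ∑ i ∈ range δ, a (s + i) + a (s + δ) :=
      Finset.sum_range_succ _ _
    have h2 : ∑ i ∈ range (δ + 1), a (s + i) = ∑ i ∈ range δ, a (s + 1 + i) + a s := by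
      rw [Finset.sum_range_succ']
      simp only [add_zero, add_assoc, add_comm 1]
    rw [show s + 1 + δ = s + δ + 1 by ring, Finset.sum_range_succ]
    have h3 := hsec s
    omega

/-! ### Step 1: a form of degree `δ` in `Ann(F)` that is a non-zero-divisor modulo `I` -/

section NZD

variable [Fintype σ]

/-- An operator of higher degree than the form it acts on acts by zero. [folklore] -/
private theorem apolarAction_eq_zero_of_degree_lt {D f : MvPolynomial σ K} {i m : ℕ}
    (hD : D.IsHomogeneous i) (hf : f.IsHomogeneous m) (h : m < i) : apolarAction D f = 0 := by
  classical
  rw [apolarAction_def]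
  refine Finset.sum_eq_zero fun e he => Finset.sum_eq_zero fun d hd => ?_
  have h1 : e.degree = i := by rw [Finsupp.degree_eq_weight_one]; exact hD (mem_support_iff.1 he)
  have h2 : d.degree = m := by rw [Finsupp.degree_eq_weight_one]; exact hf (mem_support_iff.1 hd)
  have hed : ¬ e ≤ d := by
    intro hle
    have := Finsupp.degree_mono hle
    omega
  obtain ⟨x, hx⟩ : ∃ x, d x < e x := by
    by_contra hcon
    push Not at hcon
    exact hed fun x => hcon x
  have hxe : x ∈ e.support := Finsupp.mem_support_iff.2 (by omega)
  rw [Finset.prod_eq_zero hxe (by rw [Nat.descFactorial_eq_zero_iff_lt.2 hx, Nat.cast_zero]),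
    mul_zero, monomial_zero]

omit [Fintype σ] in
/-- Colon bookkeeping in `S ⧸ I`: `r • (f mod I) = 0 ↔ r f ∈ I`. [folklore] -/
private theorem mem_colon_bot_mk_iff {I : Ideal (MvPolynomial σ K)} {r f : MvPolynomial σ K} :
    r ∈ (⊥ : Submodule (MvPolynomial σ K) (MvPolynomial σ K ⧸ I)).colon {Ideal.Quotient.mk I f} ↔
      r * f ∈ I := by
  rw [Submodule.mem_colon_singleton, Submodule.mem_bot]
  exact Ideal.Quotient.eq_zero_iff_mem

/-- **Saturation keeps the irrelevant ideal away from the associated primes**: if `I` is saturated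
(`(∀ i, X i * f ∈ I) → f ∈ I`), then every associated prime of `S ⧸ I` misses some variable.
[folklore] -/
private theorem exists_X_notMem_of_isAssociatedPrime {I : Ideal (MvPolynomial σ K)}
    (hsat : ∀ f, (∀ i, X i * f ∈ I) → f ∈ I) {P : Ideal (MvPolynomial σ K)}
    (hP : IsAssociatedPrime P (MvPolynomial σ K ⧸ I)) : ∃ i, (X i : MvPolynomial σ K) ∉ P := by
  rw [isAssociatedPrime_iff] at hP
  obtain ⟨hPprime, x, rfl⟩ := hP
  by_contra h
  push Not at h
  obtain ⟨y, rfl⟩ := Ideal.Quotient.mk_surjective x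
  have hy : y ∈ I := hsat y fun i => mem_colon_bot_mk_iff.1 (h i)
  refine hPprime.ne_top (eq_top_iff.2 fun r _ => ?_)
  rw [Submodule.mem_colon_singleton, Submodule.mem_bot, Ideal.Quotient.eq_zero_iff_mem.2 hy, smul_zero]

/-- For a form `F` of degree `m` whose apolar ideal is generated by forms of degree `≤ δ`, and a
saturated ideal `I`: the degree-`δ` piece `Ann(F)_δ` lies in NO associated prime of `S ⧸ I`
(because `Ann(F) ⊇ 𝔪^{m+1}` and such a prime misses a variable). [folklore] -/
private theorem not_idealDegree_annihilatorIdeal_le {F : MvPolynomial σ K} {m : ℕ} (hF : F.IsHomogeneous m)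
    {δ : ℕ} {G : Set (MvPolynomial σ K)} (hG : ∀ g ∈ G, ∃ j ≤ δ, g.IsHomogeneous j)
    (hgen : annihilatorIdeal F = Ideal.span G) {I : Ideal (MvPolynomial σ K)}
    (hsat : ∀ f, (∀ i, X i * f ∈ I) → f ∈ I) {P : Ideal (MvPolynomial σ K)}
    (hP : IsAssociatedPrime P (MvPolynomial σ K ⧸ I)) :
    ¬ idealDegree (annihilatorIdeal F) δ ≤ P.restrictScalars K := by
  intro hle
  obtain ⟨i₀, hi₀⟩ := exists_X_notMem_of_isAssociatedPrime hsat hP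
  have hPprime := hP.isPrime
  apply hi₀
  by_cases hall : ∀ g ∈ G, g ∈ P
  · have h1 : annihilatorIdeal F ≤ P := hgen.le.trans (Ideal.span_le.2 hall)
    have h2 : (X i₀ : MvPolynomial σ K) ^ (m + 1) ∈ annihilatorIdeal F := by
      rw [mem_annihilatorIdeal_iff]
      exact apolarAction_eq_zero_of_degree_lt (((isHomogeneous_X K i₀).pow (m + 1))) hF (by omega)
    exact hPprime.mem_of_pow_mem (m + 1) (h1 h2)
  · push Not at hall
    obtain ⟨g, hgG, hgP⟩ := hall
    obtain ⟨j, hjδ, hgj⟩ := hG g hgG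
    have hgAnn : g ∈ annihilatorIdeal F := hgen.ge (Ideal.subset_span hgG)
    have hmem : (X i₀ : MvPolynomial σ K) ^ (δ - j) * g ∈ idealDegree (annihilatorIdeal F) δ := by
      rw [mem_idealDegree]
      refine ⟨Ideal.mul_mem_left _ _ hgAnn, ?_⟩
      have := ((isHomogeneous_X K i₀).pow (δ - j)).mul hgj
      rwa [show 1 * (δ - j) + j = δ by omega] at this
    rcases hPprime.mem_or_mem (hle hmem) with h | h
    · exact hPprime.mem_of_pow_mem _ h
    · exact absurd h hgP

/-- **The non-zero-divisor** (the form `g` of Ranestad–Schreyer's proof: a degree-`δ` element of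
`Ann(F)` "that does not contain any component of `Γ`"): over an INFINITE field, for `I ≠ ⊤`
saturated, some `g ∈ Ann(F)_δ`, `g ≠ 0`, is a non-zero-divisor modulo `I` — by avoidance of the
finitely many associated primes inside the vector space `Ann(F)_δ`. [cite: RanestadSchreyer2011, Proposition 1 (proof)] -/
theorem exists_nonZeroDivisor_mem_idealDegree [Infinite K] {F : MvPolynomial σ K} {m : ℕ}
    (hF : F.IsHomogeneous m) {δ : ℕ} {G : Set (MvPolynomial σ K)}
    (hG : ∀ g ∈ G, ∃ j ≤ δ, g.IsHomogeneous j) (hgen : annihilatorIdeal F = Ideal.span G)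
    {I : Ideal (MvPolynomial σ K)} (hsat : ∀ f, (∀ i, X i * f ∈ I) → f ∈ I) (hI : I ≠ ⊤) :
    ∃ g ∈ idealDegree (annihilatorIdeal F) δ, g ≠ 0 ∧ ∀ f, g * f ∈ I → f ∈ I := by
  classical
  have hfin := associatedPrimes.finite (A := MvPolynomial σ K) (M := MvPolynomial σ K ⧸ I)
  obtain ⟨g, hgV, hgT⟩ := exists_mem_forall_notMem_of_forall_not_le
    (idealDegree (annihilatorIdeal F) δ) (hfin.toFinset.image fun P => P.restrictScalars K)
    (by
      intro W hW
      obtain ⟨P, hP, rfl⟩ := Finset.mem_image.1 hW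
      exact not_idealDegree_annihilatorIdeal_le hF hG hgen hsat (hfin.mem_toFinset.1 hP))
  have hgP : ∀ P ∈ associatedPrimes (MvPolynomial σ K) (MvPolynomial σ K ⧸ I), g ∉ P := fun P hP =>
    hgT _ (Finset.mem_image_of_mem _ (hfin.mem_toFinset.2 hP))
  refine ⟨g, hgV, ?_, ?_⟩
  · haveI : Nontrivial (MvPolynomial σ K ⧸ I) := Ideal.Quotient.nontrivial_iff.2 hI
    obtain ⟨P, hP⟩ := associatedPrimes.nonempty (MvPolynomial σ K) (MvPolynomial σ K ⧸ I)
    intro hg0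
    exact hgP P hP (by rw [hg0]; exact zero_mem _)
  · intro f hgf
    by_contra hf
    have hx : Ideal.Quotient.mk I f ≠ 0 := mt Ideal.Quotient.eq_zero_iff_mem.1 hf
    obtain ⟨P, hP, hle⟩ := exists_le_isAssociatedPrime_of_isNoetherianRing (MvPolynomial σ K) _ hx
    exact hgP P hP (hle (mem_colon_bot_mk_iff.2 hgf))

end NZD

/-! ### Step 2: Ranestad–Schreyer, Proposition 1 (scheme version) -/

end CactusBound

open CactusBound

section Main

variable {K : Type*} [Field K] {σ : Type*} [Fintype σ]

/-- **Ranestad–Schreyer 2011, Proposition 1 — for SCHEMES** (= Shafiei 2015, Prop. 3.4), in the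
tree's Hilbert-function vocabulary. Printed: "If the ideal of `F^⊥` is generated in degree `d` and
`Γ ⊂ 𝐏(T₁)` is a finite apolar subscheme to `F`, then `deg Γ ≥ (1/d) deg F^⊥`", where
`deg F^⊥ = length S/F^⊥` and "apolar" means `I_Γ ⊂ F^⊥` for the (saturated) homogeneous ideal
`I_Γ` of `Γ`. DICTIONARY (typed ↔ printed): `I` homogeneous and SATURATED
(`(∀ i, X_i·f ∈ I) → f ∈ I`, i.e. `I : 𝔪 = I`) with Hilbert function `H(S/I; t) = e` for all
`t ≥ t₀` ⟺ `I = I_Γ` for a zero-dimensional subscheme `Γ ⊂ 𝐏(S₁)` of degree `e` (or `I = S`,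
`e = 0`, excluded here by `I ⊆ Ann F ∌ 1` when `F ≠ 0`); `I ≤ annihilatorIdeal F` ⟺ `Γ` apolar
to `F`; "generated in degree `d`" is typed as "generated by forms of degree `≤ δ`" (the reading the
source itself uses in its Cor. 2); conclusion `Σ_{t ≤ T} H(S/Ann F; t) ≤ δ·e` for every `T`, i.e.
`length(S/Ann F) ≤ δ · deg Γ`. The field is assumed INFINITE (used only to choose the auxiliary
hypersurface `g`; the source works over any field). Proof = the printed Bézout argument made
algebraic: `g ∈ Ann(F)_δ` a non-zero-divisor mod `I` (`exists_nonZeroDivisor_mem_idealDegree`),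
`I + (g) ⊆ Ann F`, and `length S/(I + (g)) = δ · e` by the hypersurface-section formula
(Philippon, `hilbert_sup_span_add_hilbert_eq`) and telescoping. [cite: RanestadSchreyer2011, Proposition 1] -/
theorem sum_hilbertFunction_annihilatorIdeal_le_mul_degree [Infinite K] {F : MvPolynomial σ K}
    {m : ℕ} (hF : F.IsHomogeneous m) {δ : ℕ} {G : Set (MvPolynomial σ K)}
    (hG : ∀ g ∈ G, ∃ j ≤ δ, g.IsHomogeneous j) (hgen : annihilatorIdeal F = Ideal.span G)
    {I : Ideal (MvPolynomial σ K)} (hIhom : I.IsHomogeneous (homogeneousSubmodule σ K))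
    (hsat : ∀ f, (∀ i, X i * f ∈ I) → f ∈ I) (hIF : I ≤ annihilatorIdeal F) {e t₀ : ℕ}
    (he : ∀ t, t₀ ≤ t →
      finrank K (homogeneousSubmodule σ K t) - finrank K (idealDegree I t) = e)
    (T : ℕ) :
    ∑ t ∈ range (T + 1), (finrank K (homogeneousSubmodule σ K t) -
        finrank K (idealDegree (annihilatorIdeal F) t)) ≤ δ * e := by
  classical
  by_cases hF0 : F = 0
  · have htop : annihilatorIdeal F = ⊤ := by
      rw [eq_top_iff]
      intro D _
      rw [mem_annihilatorIdeal_iff, hF0, apolarAction_zero_right]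
    rw [Finset.sum_eq_zero fun t _ => ?_]
    · exact Nat.zero_le _
    rw [htop]
    exact Literature.RingTheory.MvPolynomial.finrank_homogeneousSubmodule_sub_finrank_idealDegree_top t
  have hI : I ≠ ⊤ := by
    intro h
    apply hF0
    have h1 : (1 : MvPolynomial σ K) ∈ annihilatorIdeal F := hIF (h ▸ Submodule.mem_top)
    rwa [mem_annihilatorIdeal_iff, ← C_1, apolarAction_C, one_smul] at h1
  obtain ⟨g, hgV, hg0, hnzd⟩ := exists_nonZeroDivisor_mem_idealDegree hF hG hgen hsat hI
  rw [mem_idealDegree] at hgV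
  obtain ⟨hgAnn, hgδ⟩ := hgV
  have hJ : I ⊔ Ideal.span {g} ≤ annihilatorIdeal F :=
    sup_le hIF ((Ideal.span_singleton_le_iff_mem _).2 hgAnn)
  set a : ℕ → ℕ := fun t => finrank K (homogeneousSubmodule σ K t) - finrank K (idealDegree I t)
    with ha
  set b : ℕ → ℕ := fun t =>
    finrank K (homogeneousSubmodule σ K t) - finrank K (idealDegree (I ⊔ Ideal.span {g}) t) with hb
  have hba : ∀ t, b t ≤ a t := fun t => hilbert_antitone (le_sup_left : I ≤ I ⊔ Ideal.span {g}) t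
  have hsec : ∀ s, b (s + δ) + a s = a (s + δ) := fun s =>
    hilbert_sup_span_add_hilbert_eq hIhom hg0 hgδ hnzd s
  set s := t₀ + T + 1 with hs
  calc ∑ t ∈ range (T + 1), (finrank K (homogeneousSubmodule σ K t) -
          finrank K (idealDegree (annihilatorIdeal F) t))
      ≤ ∑ t ∈ range (T + 1), b t := Finset.sum_le_sum fun t _ => hilbert_antitone hJ t
    _ ≤ ∑ t ∈ range (s + δ), b t :=
        Finset.sum_le_sum_of_subset (Finset.range_subset_range.2 (by omega))
    _ ≤ ∑ i ∈ range δ, a (s + i) := sum_range_le_sum_window a b δ hba hsec s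
    _ = ∑ i ∈ range δ, e := Finset.sum_congr rfl fun i _ => he _ (by omega)
    _ = δ * e := by rw [Finset.sum_const, Finset.card_range, smul_eq_mul]

/-- **Ranestad–Schreyer 2011, Corollary 1** ("If the ideal of `F^⊥` is generated in degree `d`,
then the cactus rank `cr(F) ≥ (1/d) deg F^⊥`"), as the universally quantified bound it abbreviates:
for EVERY zero-dimensional scheme `Γ` apolar to `F` (every homogeneous saturated `I ⊆ Ann F` with
Hilbert function eventually `e = deg Γ`), `length(S/Ann F) ≤ δ · e` — the length written as the
finite sum `Σ_{t ≤ m} H(S/Ann F; t)` over the degrees `≤ deg F` (above `deg F` the Hilbert function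
of `Ann F` vanishes). Infinite field. [cite: RanestadSchreyer2011, Corollary 1] -/
theorem sum_hilbertFunction_annihilatorIdeal_le_mul_degree' [Infinite K] {F : MvPolynomial σ K}
    {m : ℕ} (hF : F.IsHomogeneous m) {δ : ℕ} {G : Set (MvPolynomial σ K)}
    (hG : ∀ g ∈ G, ∃ j ≤ δ, g.IsHomogeneous j) (hgen : annihilatorIdeal F = Ideal.span G)
    {I : Ideal (MvPolynomial σ K)} (hIhom : I.IsHomogeneous (homogeneousSubmodule σ K))
    (hsat : ∀ f, (∀ i, X i * f ∈ I) → f ∈ I) (hIF : I ≤ annihilatorIdeal F) {e t₀ : ℕ}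
    (he : ∀ t, t₀ ≤ t →
      finrank K (homogeneousSubmodule σ K t) - finrank K (idealDegree I t) = e) :
    ∑ t ∈ range (m + 1), (finrank K (homogeneousSubmodule σ K t) -
        finrank K (idealDegree (annihilatorIdeal F) t)) ≤ δ * e :=
  sum_hilbertFunction_annihilatorIdeal_le_mul_degree hF hG hgen hIhom hsat hIF he m

/-- Above the degree of the form the apolar ideal is everything: `Ann(F)_t = S_t` for `t > deg F`
(Shafiei 2015, §1: "If `h ∈ S_k` and `F ∈ R_n`, then we have `h ∘ F ∈ R_{n−k}`", which is `0` for
`k > n`). [cite: Shafiei2015, Section 1 (Definition 1.1)] -/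
theorem idealDegree_annihilatorIdeal_eq_top_of_lt {F : MvPolynomial σ K} {m : ℕ}
    (hF : F.IsHomogeneous m) {t : ℕ} (hmt : m < t) :
    idealDegree (annihilatorIdeal F) t = homogeneousSubmodule σ K t := by
  refine le_antisymm (fun D hD => (mem_idealDegree.1 hD).2) fun D hD => ?_
  rw [mem_idealDegree]
  refine ⟨?_, hD⟩
  rw [mem_annihilatorIdeal_iff]
  exact apolarAction_eq_zero_of_degree_lt ((mem_homogeneousSubmodule t D).1 hD) hF hmt

/-- Hence `H(S/Ann F; t) = 0` for `t > deg F`: the length `Σ_t H(S/Ann F; t)` is the finite sum over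
`t ≤ deg F`. [cite: Shafiei2015, Section 1 (Definition 1.1)] -/
theorem hilbertFunction_annihilatorIdeal_eq_zero_of_lt {F : MvPolynomial σ K} {m : ℕ}
    (hF : F.IsHomogeneous m) {t : ℕ} (hmt : m < t) :
    finrank K (homogeneousSubmodule σ K t) - finrank K (idealDegree (annihilatorIdeal F) t) = 0 := by
  rw [idealDegree_annihilatorIdeal_eq_top_of_lt hF hmt, Nat.sub_self]

/-- The truncated sums `Σ_{t ≤ T} H(S/Ann F; t)` are all equal to the length `Σ_{t ≤ deg F}` once
`T ≥ deg F` ("`deg(Ann(F)) = dim(S/Ann(F))` is the length of the `0`-dimensional scheme defined by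
`Ann(F)`", Shafiei 2015, Prop. 3.4). [cite: Shafiei2015, Proposition 3.4] -/
theorem sum_hilbertFunction_annihilatorIdeal_eq_of_le {F : MvPolynomial σ K} {m : ℕ}
    (hF : F.IsHomogeneous m) {T : ℕ} (hmT : m ≤ T) :
    ∑ t ∈ range (T + 1), (finrank K (homogeneousSubmodule σ K t) -
        finrank K (idealDegree (annihilatorIdeal F) t)) =
      ∑ t ∈ range (m + 1), (finrank K (homogeneousSubmodule σ K t) -
        finrank K (idealDegree (annihilatorIdeal F) t)) := by
  symm
  refine Finset.sum_subset (Finset.range_subset_range.2 (by omega)) fun t ht ht' => ?_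
  rw [Finset.mem_range, not_lt] at ht'
  exact hilbertFunction_annihilatorIdeal_eq_zero_of_lt hF (by omega)

end Main

namespace CactusBound

variable {K : Type*} [Field K] {σ : Type*}

/-! ### Step 3: the dimension form — `dim S/I = 1` gives an eventually constant Hilbert function -/

section Dimension

/-- **Zero-dimensional schemes have constant Hilbert polynomial** (Hartshorne I.7.5 at `dim = 0`):
for a homogeneous ideal `I ⊆ K[X_0, …, X_{N-1}]` (`K` infinite) with `dim S/I = 1` (projectively: a
non-empty finite subscheme), the Hilbert function `H(S/I; t)` is eventually a POSITIVE constant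
`e` (= `deg Γ`). From the tree's `exists_hilbertPolynomial` and `natDegree_hilbertPolynomial`.
[cite: Hartshorne1977, Ch. I Thm. 7.5] -/
theorem exists_hilbertFunction_eventually_const [Infinite K] {N : ℕ}
    {I : Ideal (MvPolynomial (Fin N) K)} (hIhom : I.IsHomogeneous (homogeneousSubmodule (Fin N) K))
    (hdim : ringKrullDim (MvPolynomial (Fin N) K ⧸ I) = 1) :
    ∃ e t₀ : ℕ, 0 < e ∧ ∀ t, t₀ ≤ t →
      finrank K (homogeneousSubmodule (Fin N) K t) - finrank K (idealDegree I t) = e := by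
  obtain ⟨p, t₀, hp⟩ := Literature.RingTheory.MvPolynomial.exists_hilbertPolynomial I hIhom
  have hdim' : ringKrullDim (MvPolynomial (Fin N) K ⧸ I) = ((0 + 1 : ℕ) : WithBot ℕ∞) := by
    rw [hdim]; rfl
  obtain ⟨hdeg, hlc⟩ := Literature.RingTheory.MvPolynomial.natDegree_hilbertPolynomial hIhom hdim' hp
  have hpC : p = Polynomial.C (p.coeff 0) := Polynomial.eq_C_of_natDegree_eq_zero hdeg
  have hev : ∀ t, t₀ ≤ t →
      ((finrank K (homogeneousSubmodule (Fin N) K t) - finrank K (idealDegree I t) : ℕ) : ℚ) =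
        p.coeff 0 := by
    intro t ht
    rw [hp t ht]
    conv_lhs => rw [hpC]
    rw [Polynomial.eval_C]
  refine ⟨finrank K (homogeneousSubmodule (Fin N) K t₀) - finrank K (idealDegree I t₀), t₀, ?_, ?_⟩
  · have h1 : (1 : ℚ) ≤ p.coeff 0 := by
      have : p.leadingCoeff = p.coeff 0 := by rw [Polynomial.leadingCoeff, hdeg]
      rw [this, Nat.factorial_zero, Nat.cast_one, inv_one] at hlc
      exact hlc
    have h2 : ((1 : ℕ) : ℚ) ≤
        ((finrank K (homogeneousSubmodule (Fin N) K t₀) - finrank K (idealDegree I t₀) : ℕ) : ℚ) := by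
      rw [hev t₀ le_rfl, Nat.cast_one]
      exact h1
    exact Nat.succ_le_iff.1 (by exact_mod_cast h2)
  · intro t ht
    exact_mod_cast (hev t ht).trans (hev t₀ le_rfl).symm

end Dimension

/-! ### Step 3b: renaming the variables (to use the `Fin N`-indexed dimension theory for any `σ`) -/

section Transport

variable {τ : Type*}

/-- Renaming along a bijection maps `S_t` onto `S'_t`. [folklore] -/
private theorem map_renameEquiv_homogeneousSubmodule (θ : σ ≃ τ) (t : ℕ) :
    (homogeneousSubmodule σ K t).map
        ((renameEquiv K θ).toLinearEquiv : MvPolynomial σ K →ₗ[K] MvPolynomial τ K) =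
      homogeneousSubmodule τ K t := by
  ext D
  rw [Submodule.mem_map_equiv, mem_homogeneousSubmodule, mem_homogeneousSubmodule]
  change (rename θ.symm D).IsHomogeneous t ↔ _
  exact IsHomogeneous.rename_isHomogeneous_iff θ.symm.injective

/-- Renaming along a bijection maps `I_t` onto `(θ I)_t`. [folklore] -/
private theorem map_renameEquiv_idealDegree (θ : σ ≃ τ) (I : Ideal (MvPolynomial σ K)) (t : ℕ) :
    (idealDegree I t).map
        ((renameEquiv K θ).toLinearEquiv : MvPolynomial σ K →ₗ[K] MvPolynomial τ K) =
      idealDegree (I.map ((renameEquiv K θ).toRingEquiv : MvPolynomial σ K →+* MvPolynomial τ K)) t := by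
  ext D
  rw [Submodule.mem_map_equiv, mem_idealDegree, mem_idealDegree,
    Ideal.map_comap_of_equiv (renameEquiv K θ).toRingEquiv, Ideal.mem_comap]
  change rename θ.symm D ∈ I ∧ (rename θ.symm D).IsHomogeneous t ↔
    rename θ.symm D ∈ I ∧ D.IsHomogeneous t
  rw [IsHomogeneous.rename_isHomogeneous_iff θ.symm.injective]

/-- **The Hilbert function is invariant under renaming the variables along a bijection.**
[folklore] -/
private theorem hilbertFunction_map_renameEquiv (θ : σ ≃ τ) (I : Ideal (MvPolynomial σ K)) (t : ℕ) :
    finrank K (homogeneousSubmodule τ K t) -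
        finrank K (idealDegree
          (I.map ((renameEquiv K θ).toRingEquiv : MvPolynomial σ K →+* MvPolynomial τ K)) t) =
      finrank K (homogeneousSubmodule σ K t) - finrank K (idealDegree I t) := by
  rw [← map_renameEquiv_homogeneousSubmodule θ t, ← map_renameEquiv_idealDegree θ I t,
    LinearEquiv.finrank_map_eq, LinearEquiv.finrank_map_eq]

/-- Renaming along a bijection preserves homogeneity of ideals (a homogeneous ideal is spanned by
homogeneous elements, which rename to homogeneous elements). [folklore] -/
private theorem isHomogeneous_map_renameEquiv (θ : σ ≃ τ) {I : Ideal (MvPolynomial σ K)}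
    (hI : I.IsHomogeneous (homogeneousSubmodule σ K)) :
    (I.map ((renameEquiv K θ).toRingEquiv : MvPolynomial σ K →+* MvPolynomial τ K)).IsHomogeneous
      (homogeneousSubmodule τ K) := by
  obtain ⟨S, rfl⟩ := (Ideal.IsHomogeneous.iff_exists _ _).1 hI
  rw [Ideal.map_span]
  refine Ideal.homogeneous_span _ _ fun x hx => ?_
  obtain ⟨y, hy, rfl⟩ := hx
  obtain ⟨z, -, rfl⟩ := hy
  obtain ⟨i, hi⟩ := z.2
  exact ⟨i, (mem_homogeneousSubmodule i _).2
    (((mem_homogeneousSubmodule i _).1 hi).rename_isHomogeneous)⟩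

/-- **Zero-dimensional schemes have an eventually constant positive Hilbert function** — for any
finite index type of variables (transport of `exists_hilbertFunction_eventually_const` along
`σ ≃ Fin N`). [cite: Hartshorne1977, Ch. I Thm. 7.5] -/
theorem exists_hilbertFunction_eventually_const' [Infinite K] [Fintype σ] {I : Ideal (MvPolynomial σ K)}
    (hIhom : I.IsHomogeneous (homogeneousSubmodule σ K))
    (hdim : ringKrullDim (MvPolynomial σ K ⧸ I) = 1) :
    ∃ e t₀ : ℕ, 0 < e ∧ ∀ t, t₀ ≤ t →
      finrank K (homogeneousSubmodule σ K t) - finrank K (idealDegree I t) = e := by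
  classical
  set θ := Fintype.equivFin σ
  set ρ : MvPolynomial σ K ≃+* MvPolynomial (Fin (Fintype.card σ)) K := (renameEquiv K θ).toRingEquiv
  set I' := I.map (ρ : MvPolynomial σ K →+* MvPolynomial (Fin (Fintype.card σ)) K) with hI'
  have hdim' : ringKrullDim (MvPolynomial (Fin (Fintype.card σ)) K ⧸ I') = 1 := by
    rw [← hdim]
    exact (RingEquiv.ringKrullDim (Ideal.quotientEquiv I I' ρ rfl)).symm
  obtain ⟨e, t₀, he0, he⟩ :=
    exists_hilbertFunction_eventually_const (isHomogeneous_map_renameEquiv θ hIhom) hdim'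
  refine ⟨e, t₀, he0, fun t ht => ?_⟩
  rw [← he t ht, ← hilbertFunction_map_renameEquiv θ I t]

end Transport

/-! ### Step 4: the combined dimension form, and Shafiei's Theorem 3.5 for schemes -/

end CactusBound

section Corollaries

variable {K : Type*} [Field K] {σ : Type*}

/-- **Ranestad–Schreyer, Prop. 1, dimension form** (`K` infinite, finitely many variables): if
`Ann(F)` is generated by forms of degree `≤ δ` and `I ⊆ Ann(F)` is a homogeneous saturated ideal
with `dim S/I = 1` — i.e. `I = I_Γ` for a NON-EMPTY zero-dimensional scheme `Γ ⊂ 𝐏(S₁)` apolar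
to `F` — then `Γ` has a positive degree `e` (the eventual value of `H(S/I; ·)`) and
`length(S/Ann F) = Σ_t H(S/Ann F; t) ≤ δ · e`, i.e. "`deg Γ ≥ (1/d) deg F^⊥`".
[cite: RanestadSchreyer2011, Proposition 1] -/
theorem exists_degree_sum_hilbertFunction_annihilatorIdeal_le [Infinite K] [Fintype σ]
    {F : MvPolynomial σ K} {m : ℕ} (hF : F.IsHomogeneous m) {δ : ℕ}
    {G : Set (MvPolynomial σ K)} (hG : ∀ g ∈ G, ∃ j ≤ δ, g.IsHomogeneous j)
    (hgen : annihilatorIdeal F = Ideal.span G) {I : Ideal (MvPolynomial σ K)}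
    (hIhom : I.IsHomogeneous (homogeneousSubmodule σ K))
    (hsat : ∀ f, (∀ i, X i * f ∈ I) → f ∈ I) (hIF : I ≤ annihilatorIdeal F)
    (hdim : ringKrullDim (MvPolynomial σ K ⧸ I) = 1) :
    ∃ e : ℕ, 0 < e ∧
      (∃ t₀ : ℕ, ∀ t, t₀ ≤ t →
        finrank K (homogeneousSubmodule σ K t) - finrank K (idealDegree I t) = e) ∧
      ∀ T : ℕ, ∑ t ∈ range (T + 1), (finrank K (homogeneousSubmodule σ K t) -
        finrank K (idealDegree (annihilatorIdeal F) t)) ≤ δ * e := by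
  obtain ⟨e, t₀, he0, he⟩ := exists_hilbertFunction_eventually_const' hIhom hdim
  exact ⟨e, he0, ⟨t₀, he⟩, fun T =>
    sum_hilbertFunction_annihilatorIdeal_le_mul_degree hF hG hgen hIhom hsat hIF he T⟩

/-- The generators `𝒰_D ∪ 𝒫_D` of `Ann(det_n)` are forms of degree `≤ 2` (indeed `= 2`,
`isHomogeneous_two_of_mem_generators`). [cite: Shafiei2015, Theorem 2.12] -/
private theorem exists_le_two_isHomogeneous_of_mem_generators_det (n : ℕ)
    (g : MvPolynomial (Fin n × Fin n) K) (hg : g ∈ unacceptableQuadrics n K ∪ twoByTwoPerms n K) :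
    ∃ j ≤ 2, g.IsHomogeneous j := by
  refine ⟨2, le_rfl, isHomogeneous_two_of_mem_generators (-1 : K) ?_⟩
  rwa [crossRel_neg_one]

/-- The generators `𝒰_D ∪ ℳ_D` of `Ann(perm_n)` are forms of degree `≤ 2`.
[cite: Shafiei2015, Theorem 2.13] -/
private theorem exists_le_two_isHomogeneous_of_mem_generators_perm (n : ℕ)
    (g : MvPolynomial (Fin n × Fin n) K) (hg : g ∈ unacceptableQuadrics n K ∪ twoByTwoMinors n K) :
    ∃ j ≤ 2, g.IsHomogeneous j := by
  refine ⟨2, le_rfl, isHomogeneous_two_of_mem_generators (1 : K) ?_⟩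
  rwa [crossRel_one]

/-- **Shafiei 2015, Theorem 3.5 — the cactus-rank inequality for the determinant**:
"`½ binom(2n,n) ≤ cr(det_n)`", i.e. EVERY zero-dimensional scheme `Γ ⊂ 𝐏(S₁)` apolar to `det_n`
has `deg Γ ≥ ½ binom(2n,n)`. Typed (dictionary of `sum_hilbertFunction_annihilatorIdeal_le_mul_degree`):
for every homogeneous saturated ideal `I ⊆ Ann(det_n)` whose Hilbert function is eventually `e`,
`binom(2n, n) ≤ 2·e`. Infinite field (the printed proof: Prop. 3.4 with `d = 2`, Thms. 2.12 and
eq. (2.2), here `annihilatorIdeal_detPoly` and `sum_hilbertFunction_annihilatorIdeal_detPoly`).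
[cite: Shafiei2015, Theorem 3.5] -/
theorem choose_le_two_mul_degree_of_apolar_detPoly [Infinite K] (n : ℕ)
    {I : Ideal (MvPolynomial (Fin n × Fin n) K)}
    (hIhom : I.IsHomogeneous (homogeneousSubmodule (Fin n × Fin n) K))
    (hsat : ∀ f, (∀ i, X i * f ∈ I) → f ∈ I) (hIF : I ≤ annihilatorIdeal (detPoly (Fin n) K))
    {e t₀ : ℕ} (he : ∀ t, t₀ ≤ t →
      finrank K (homogeneousSubmodule (Fin n × Fin n) K t) - finrank K (idealDegree I t) = e) :
    (2 * n).choose n ≤ 2 * e := by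
  have h := sum_hilbertFunction_annihilatorIdeal_le_mul_degree (detPoly_isHomogeneous (n := Fin n) (k := K))
    (exists_le_two_isHomogeneous_of_mem_generators_det n) (annihilatorIdeal_detPoly (n := n) (k := K))
    hIhom hsat hIF he n
  rwa [sum_hilbertFunction_annihilatorIdeal_detPoly K n] at h

/-- **Shafiei 2015, Theorem 3.5 — the cactus-rank inequality for the permanent**:
"`½ binom(2n,n) ≤ cr(perm_n)`": every homogeneous saturated `I ⊆ Ann(perm_n)` with Hilbert function
eventually `e` (= `I_Γ` of a zero-dimensional apolar scheme of degree `e`) has `binom(2n,n) ≤ 2·e`.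
Infinite field. [cite: Shafiei2015, Theorem 3.5] -/
theorem choose_le_two_mul_degree_of_apolar_perPoly [Infinite K] (n : ℕ)
    {I : Ideal (MvPolynomial (Fin n × Fin n) K)}
    (hIhom : I.IsHomogeneous (homogeneousSubmodule (Fin n × Fin n) K))
    (hsat : ∀ f, (∀ i, X i * f ∈ I) → f ∈ I) (hIF : I ≤ annihilatorIdeal (perPoly (Fin n) K))
    {e t₀ : ℕ} (he : ∀ t, t₀ ≤ t →
      finrank K (homogeneousSubmodule (Fin n × Fin n) K t) - finrank K (idealDegree I t) = e) :
    (2 * n).choose n ≤ 2 * e := by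
  have h := sum_hilbertFunction_annihilatorIdeal_le_mul_degree (perPoly_isHomogeneous (n := Fin n) (k := K))
    (exists_le_two_isHomogeneous_of_mem_generators_perm n) (annihilatorIdeal_perPoly (n := n) (k := K))
    hIhom hsat hIF he n
  rwa [sum_hilbertFunction_annihilatorIdeal_perPoly K n] at h

/-- **Shafiei 2015, Thm. 3.5 for `det_n`, dimension form**: every homogeneous saturated ideal
`I ⊆ Ann(det_n)` with `dim S/I = 1` (= the ideal `I_Γ` of a non-empty zero-dimensional scheme
`Γ ⊂ 𝐏^{n²-1}` apolar to `det_n`) has a positive degree `e` (eventual value of `H(S/I;·)`) with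
`binom(2n,n) ≤ 2·e`. Infinite field. [cite: Shafiei2015, Theorem 3.5] -/
theorem exists_degree_choose_le_two_mul_of_apolar_detPoly [Infinite K] (n : ℕ)
    {I : Ideal (MvPolynomial (Fin n × Fin n) K)}
    (hIhom : I.IsHomogeneous (homogeneousSubmodule (Fin n × Fin n) K))
    (hsat : ∀ f, (∀ i, X i * f ∈ I) → f ∈ I) (hIF : I ≤ annihilatorIdeal (detPoly (Fin n) K))
    (hdim : ringKrullDim (MvPolynomial (Fin n × Fin n) K ⧸ I) = 1) :
    ∃ e : ℕ, 0 < e ∧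
      (∃ t₀ : ℕ, ∀ t, t₀ ≤ t →
        finrank K (homogeneousSubmodule (Fin n × Fin n) K t) - finrank K (idealDegree I t) = e) ∧
      (2 * n).choose n ≤ 2 * e := by
  obtain ⟨e, t₀, he0, he⟩ := exists_hilbertFunction_eventually_const' hIhom hdim
  exact ⟨e, he0, ⟨t₀, he⟩, choose_le_two_mul_degree_of_apolar_detPoly n hIhom hsat hIF he⟩

/-- **Shafiei 2015, Thm. 3.5 for `perm_n`, dimension form**: every homogeneous saturated ideal
`I ⊆ Ann(perm_n)` with `dim S/I = 1` has a positive degree `e` with `binom(2n,n) ≤ 2·e`.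
Infinite field. [cite: Shafiei2015, Theorem 3.5] -/
theorem exists_degree_choose_le_two_mul_of_apolar_perPoly [Infinite K] (n : ℕ)
    {I : Ideal (MvPolynomial (Fin n × Fin n) K)}
    (hIhom : I.IsHomogeneous (homogeneousSubmodule (Fin n × Fin n) K))
    (hsat : ∀ f, (∀ i, X i * f ∈ I) → f ∈ I) (hIF : I ≤ annihilatorIdeal (perPoly (Fin n) K))
    (hdim : ringKrullDim (MvPolynomial (Fin n × Fin n) K ⧸ I) = 1) :
    ∃ e : ℕ, 0 < e ∧
      (∃ t₀ : ℕ, ∀ t, t₀ ≤ t →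
        finrank K (homogeneousSubmodule (Fin n × Fin n) K t) - finrank K (idealDegree I t) = e) ∧
      (2 * n).choose n ≤ 2 * e := by
  obtain ⟨e, t₀, he0, he⟩ := exists_hilbertFunction_eventually_const' hIhom hdim
  exact ⟨e, he0, ⟨t₀, he⟩, choose_le_two_mul_degree_of_apolar_perPoly n hIhom hsat hIF he⟩

end Corollaries


end Literature.Computability.AlgebraicComplexity

end
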